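import Literature.MathematicalPhysics.QuantumFieldTheory.Balaban1983to89.B16Ineq17MinimizerError

/-!
# `Balaban1983to89.B16Ineq17MinimizerErrorVariational` — [Balaban1989LargeFieldII] p. 357 (the steps behind (1.7)), third file:
# the minimizer-replacement error `E_H` FROM MINIMALITY — *«Replacing the minimizer in this form by the kᵗʰ minimizer defined on the
# whole lattice … we change the form by a quadratic form bounded by O(exp(−R_k))»* WITHOUT a majorant of the DIFFERENCE of the two
# minimizers: each minimizer beats the CUT-OFF of the other, and the cut-off costs only the far mass of a decaying kernel

statement-level skeleton of published theorems with citation tags; proofs where landed; nothing here is a claim about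
the Yang–Mills mass gap.

Cell pub-ymgap, HUMAN RULING D-0062 ∕ D-0149 (width seats), seat `pub-ymgap-dag-n10-w3` g0 (REBALANCE № 10 of plan g80: W-SEAT START LIST §n12
letter (c) = the replacement letter `hER` of r13's `B16Ineq17Assembly.ineq17_of_inputs`; key K1⁷ stmt-QuantumFields-20542, helper, count-neutral).
Sequel of dag-n12-b's `B16Ineq17ZetaError` (the `ζ₀ → 1` half `E_ζ` from ONE block-`ℓ²` majorant) and `B16Ineq17MinimizerError` (the
minimizer half `E_H` from THREE majorants: of `T = ∂∘H_k`, of `T_Z = ∂∘H_{1,k,Z}`, and of the DIFFERENCE `T_Z − T` on `Λ`-inputs with an extra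
`e^{−δR′}` — the last one declared there «a [13]-type localisation input», i.e. not a printed statement).  T. Bałaban, CMP **122** (1989) 355–392
[Balaban1989LargeFieldII] p. 357 [PDF 3] (text layer re-read by this seat 2026-08-28); block calculus of [Balaban1984PropagatorsII] (2.52) p. 232,
(2.61) p. 234, (2.140) p. 247 in p22's `ℓ²` form (`B6RandomWalkL2`); the variational characterisation of the minimizers: [Balaban1984PropagatorsII]
(2.5)–(2.6) p. 224 («We consider the functional A → Σ_p η^d|(∂A)(p)|² (2.5) for A fixed outside Ω₁ and with fixed averages inside Ω₁»), (2.35)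
p. 228; [Balaban1984PropagatorsI] p. 29 («H_kB is a minimum of ½⟨∂A, ∂A⟩ on the hyperplane {A : Q_kA = B, R∂*A = 0}», (1.65)–(1.66)).

THE OBSERVATION TYPED HERE.  The two minimizers `A = H u` (whole lattice) and `A_Z = H_Z u` (region `Z`) MINIMISE the same local quadratic form
`‖∂A‖²` over two affine constraint sets `Fib u`, `Fib_Z u` which AGREE near the data: every constraint touching a block within distance `R′` of the
blocks `S′ ⊇ supp u` is the same `k`-level average condition in both, and every other constraint is HOMOGENEOUS (zero averages, zero Dirichlet
data).  Hence a BLOCK CUT-OFF `χ` (`χ = 1` on the fine bonds of the blocks within `R′` of `S′`, `χ = 0` beyond; block-constant, so it commutes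
with Bałaban's block averages) EXCHANGES the fibres: `A ∈ Fib u ⇒ χA ∈ Fib_Z u` and `A ∈ Fib_Z u ⇒ χA ∈ Fib u`.  Minimality then gives
`‖∂A_Z‖ ≤ ‖∂(χA)‖ ≤ ‖∂A‖ + ‖∂‖·‖(1 − χ)A‖` and symmetrically, and `‖(1 − χ)A‖` is the FAR MASS of a kernel with a block-`ℓ²` majorant
`≤ Ce^{−δd}` ((2.151)₁ of [11] Cor. 2.8 for the minimizers themselves), exponentially small in `R′` by the block Schur test.  So print's
`O(exp(−R_k))` follows from the SINGLE-OPERATOR majorants of `H`, `H_Z`, `∂∘H`, `∂∘H_Z` and located geometry — no difference majorant.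

WHAT THIS FILE PROVES (0 `sorry`, no `def`, no new `Prop`; axioms standard; BY NAME: dag-n12-b's `blockSchur_exp`, `zetaError_le`,
`l2n_apply_le_of_exp`, `sum_blockPiece_sq_eq_sum_ite`, `ineq17_of_inputs_zeta`; p22's `l2n_*`).  Generic setting of the prequels: a block
geometry `g`, data index `X` (the coarse bonds carrying `B′`), fine index `F` (the fine bonds carrying the minimizers), output index `Y` (the
plaquettes), block maps `blkX blkF blkY`; `H H_Z : (X → ℝ) →ₗ (F → ℝ)` (the two minimizers), `D : (F → ℝ) →ₗ (Y → ℝ)` (print's `∂`).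
§1 `l2n_mask_sq_le` (a mask `|m| ≤ 1` supported over the blocks `S_F` is dominated by the pieces over `S_F`), `l2n_le_of_sq_le'`,
   ★ `farMass_le`: `‖m·(H u)‖ ≤ C·c₂·e^{−δR′∕2}·‖u‖` for `supp u ⊂` blocks of `S′`, `S_F` separated from `S′` by `R′`, half-rate row∕column sums
   between `S_F` and `S′` bounded by `c₂` (print: «by the exponential decay of the minimizer»).
§2 `l2n_sub_le`, `l2n_D_mask_le`: `‖D(χA)‖ ≤ ‖DA‖ + κ‖(1 − χ)A‖` for `‖D‖ ≤ κ` (the cut-off costs the boundary layer only through `D`'s norm).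
§3 ★ `l2n_DHZ_le` ∕ `l2n_DH_le`: `‖∂A_Z‖ ≤ ‖∂A‖ + κCc₂e^{−δR′∕2}‖u‖` and conversely, from the EXCHANGE hypotheses `‖∂A_Z‖ ≤ ‖∂(χA)‖`,
   `‖∂A‖ ≤ ‖∂(χA_Z)‖` (minimality over exchanged fibres, ONE located hypothesis each); `abs_l2n_sub_le`; ★ `abs_sq_sub_sq_le`
   (`|‖∂A_Z‖² − ‖∂A‖²| ≤ 2Cc·κC_Hc₂·e^{−δR′∕2}·‖u‖²` with the global bounds `‖∂A‖, ‖∂A_Z‖ ≤ Cc‖u‖` of the prequel).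
§4 ★★ **`minimizerError_le_variational`**: for a weight `0 ≤ w ≤ 1` with `1 − w` supported over output blocks `S` separated from `S′` by `R`
   (print's `ζ₀`): `|Σ w·(∂A_Z)² − Σ w·(∂A)²| ≤ (2κC_HCcc₂·e^{−δR′∕2} + 2C²cc′·e^{−δR})·‖u‖²` — the splitting `Σ w a² = ‖a‖² − Σ(1−w)a²`, §3 for
   the norms, the prequel's `zetaError_le` for each far part; `minimizerError_le_variational_exp_Rk` (`≤ C_H′·e^{−R_k}‖u‖²` once `R_k ≤ δR`,
   `R_k ≤ δR′∕2`).
§5 ★★ **`ineq17_of_two_majorants`** — (1.7) RE-ASSEMBLED from the majorants of `∂∘H_k`, `∂∘H_{1,k,Z}`, `H_k`, `H_{1,k,Z}`, the norm `κ` of `∂`, the two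
   exchange hypotheses, located geometry, the first-order LETTER `|E_A| ≤ C₁M⁶R_kε_k‖B′‖²` and (1.67) as `γ₀‖∂B′‖² ≤ ‖∂H_kB′‖²`: r13's leaf
   `Ineq17 Q ‖∂B′‖² ‖B′‖² γ₀ (max C₁ (…)) M R_k ε_k` — dag-n12-b's `ineq17_of_majorants` with the difference majorant `hTD` GONE.

HONEST SCOPE (located, nothing repaired).  (i) As in the prequels, the identification of the forms with (weighted) sums of squares of `∂∘H`,
and the majorants, are HYPOTHESES of printed shapes: the majorants of `H_k`∕`∂∘H_k` are [11] Cor. 2.8 (2.151)₁,₂ at the whole-torus family (tree: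
`B6Cor28EntriesKLevelV1.cor28_kLevel_H_DH` at `Domains.whole` + `B6SectAWholeTorusBridge.hOp_whole_eq_Hk`, modulo a currency junction to this
file's `blockPiece ∕ l2n` shapes); those of `H_{1,k,Z}`∕`∂∘H_{1,k,Z}` are Cor. 2.8 for the family WITH the Dirichlet level-0 layer `Λ₀ = T ∖ Z`
(print p. 228 ∕ p. 248 «minor and obvious changes for G(Ω)») — NOT in the tree at k levels (the cell's ROUTE V `TDomains` has `1 ≤ lev`): LOCATED,
see `HOME/pub-ymgap-dag-n10-w3/N12-LETTER-C-CENSUS.md` (M1).  (ii) The two EXCHANGE hypotheses are the located geometric content (block-constant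
cut-off, constraints agreeing within `R′` of `Λ`, homogeneous far constraints) + minimality ((2.5)–(2.6), (1.65)); their instantiation at NODE 00's
`H⁰_{1,k,Z}` is the dictionary item (M4) of the census.  (iii) Unweighted `ℓ²` sizes; `0 ≤ w ≤ 1` (print's `ζ₀`; the prequel allowed `|w| ≤ 1`).
Value = the one unprinted letter of the (c)-reduction removed; count-neutral; N12 NOT discharged; NOT summit progress; the Yang–Mills mass gap
(Clay) is NOT proved by any of this — R4 closes the conditional finite-𝕋⁴ rung `BalabanLadder.UV` only; nothing continuum ∕ ℝ⁴ ∕ OS.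
-/

noncomputable section

open scoped BigOperators
open Finset

namespace Literature.MathematicalPhysics.QuantumFieldTheory.Balaban1983to89.B16Ineq17MinimizerErrorVariational

open B6RandomWalk (blockPiece sum_blockPiece)
open B6RandomWalkL2 (l2n l2n_nonneg l2n_zero l2n_sq l2n_add_le l2n_smul l2n_mono)
open B16Sect1Wilson (Ineq17)
open B16Ineq17ZetaError (blockSchur_exp zetaError_le sum_blockPiece_sq_eq_sum_ite ineq17_of_inputs_zeta)
open B16Ineq17MinimizerError (l2n_apply_le_of_exp)

variable {g : B6.Geometry} {X F Y : Type} [Fintype X] [Fintype F] [Fintype Y]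
  (blkX : X → g.Site) (blkF : F → g.Site) (blkY : Y → g.Site)

/-! ## §1. The far mass of a decaying kernel -/

omit [Fintype X] [Fintype Y] in
/-- A mask `|m| ≤ 1` supported over the blocks of `S_F` is dominated by the pieces over `S_F`:
`‖m·v‖² ≤ Σ_{y ∈ S_F} ‖Δ(y)v‖²`. [cite: Balaban1984PropagatorsII, (2.52) p.232] -/
theorem l2n_mask_sq_le [DecidableEq g.Site] (SF : Finset g.Site) (m : F → ℝ) (hm : ∀ f, |m f| ≤ 1)
    (hmS : ∀ f, m f ≠ 0 → blkF f ∈ SF) (v : F → ℝ) :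
    l2n (m * v) ^ 2 ≤ ∑ y ∈ SF, l2n (blockPiece blkF y v) ^ 2 := by
  rw [sum_blockPiece_sq_eq_sum_ite blkF SF v, l2n_sq]
  refine Finset.sum_le_sum fun f _ => ?_
  by_cases h : m f = 0
  · have h0 : (m * v) f ^ 2 = 0 := by rw [Pi.mul_apply, h, zero_mul, sq, mul_zero]
    rw [h0]
    split_ifs
    · exact sq_nonneg _
    · exact le_rfl
  · rw [if_pos (hmS f h), Pi.mul_apply, mul_pow]
    have h1 : m f ^ 2 ≤ 1 := by
      have := hm f
      rw [← sq_abs]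
      nlinarith [abs_nonneg (m f)]
    nlinarith [sq_nonneg (v f)]

omit [Fintype X] in
/-- `‖v‖² ≤ (B‖u‖)²`, `B ≥ 0` ⇒ `‖v‖ ≤ B‖u‖`. [folklore] -/
private theorem l2n_le_of_sq_le' {v : F → ℝ} {u : X → ℝ} [Fintype X] {B : ℝ} (hB : 0 ≤ B)
    (h : l2n v ^ 2 ≤ (B * l2n u) ^ 2) : l2n v ≤ B * l2n u :=
  (pow_le_pow_iff_left₀ (l2n_nonneg v) (mul_nonneg hB (l2n_nonneg u)) two_ne_zero).mp h

omit [Fintype Y] in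
/-- **THE FAR MASS OF A MINIMIZER** (*«by the exponential decay of the minimizer»*): `H` with a block-`ℓ²` majorant `K_H ≤ C_H·e^{−δd}` on the
fine bonds, a mask `|m| ≤ 1` supported over fine blocks `S_F` at distance `≥ R′` from the input blocks `S′ ⊇ supp u`, half-rate row sums
(`y ∈ S_F`, over `S′`) and column sums (`y′ ∈ S′`, over `S_F`) bounded by `c₂` ⟹ `‖m·(Hu)‖ ≤ C_H·c₂·e^{−δR′∕2}·‖u‖`.
[cite: Balaban1989LargeFieldII, p.357 («By the exponential decay of the minimizer»); Balaban1984PropagatorsII, (2.151) p.249, (2.61) p.234] -/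
theorem farMass_le (H : (X → ℝ) →ₗ[ℝ] (F → ℝ)) {KH : g.Site → g.Site → ℝ}
    (hH : ∀ (y y' : g.Site) (u : X → ℝ), (∀ x, blkX x ≠ y' → u x = 0) →
      l2n (blockPiece blkF y (H u)) ≤ KH y y' * l2n u)
    (hKH0 : ∀ a b, 0 ≤ KH a b) {CH δ R' c₂ : ℝ} (hCH : 0 ≤ CH) (hδ : 0 ≤ δ) (hc₂ : 0 ≤ c₂)
    (hKH : ∀ a b, KH a b ≤ CH * Real.exp (-(δ * g.dist a b))) (SF S' : Finset g.Site)
    (hsep : ∀ y ∈ SF, ∀ y' ∈ S', R' ≤ g.dist y y')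
    (hrow : ∀ y ∈ SF, ∑ y' ∈ S', Real.exp (-(δ / 2 * g.dist y y')) ≤ c₂)
    (hcol : ∀ y' ∈ S', ∑ y ∈ SF, Real.exp (-(δ / 2 * g.dist y y')) ≤ c₂)
    (m : F → ℝ) (hm : ∀ f, |m f| ≤ 1) (hmS : ∀ f, m f ≠ 0 → blkF f ∈ SF)
    (u : X → ℝ) (hu : ∀ x, blkX x ∉ S' → u x = 0) :
    l2n (m * H u) ≤ CH * c₂ * Real.exp (-(δ * R' / 2)) * l2n u := by
  classical
  have h1 := l2n_mask_sq_le blkF SF m hm hmS (H u)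
  have h2 := blockSchur_exp blkX blkF H hH hKH0 hCH hδ hc₂ hKH SF S' hsep hrow hcol u hu
  have hB : 0 ≤ CH * c₂ * Real.exp (-(δ * R' / 2)) := by positivity
  refine l2n_le_of_sq_le' hB (h1.trans (h2.trans (le_of_eq ?_)))
  have hexp : Real.exp (-(δ * R')) = Real.exp (-(δ * R' / 2)) ^ 2 := by
    rw [sq, ← Real.exp_add]; congr 1; ring
  rw [hexp]; ring

/-! ## §2. The cut-off costs only the boundary layer through the norm of `D` -/

omit [Fintype X] in
/-- `‖a − b‖ ≤ ‖a‖ + ‖b‖` for the `ℓ²` size. [folklore] -/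
private theorem l2n_sub_le (a b : Y → ℝ) : l2n (a - b) ≤ l2n a + l2n b := by
  have h := l2n_add_le a (-b)
  have hneg : l2n (-b) = l2n b := by
    have := l2n_smul (-1 : ℝ) b
    simp only [neg_smul, one_smul, abs_neg, abs_one, one_mul] at this
    exact this
  rw [← sub_eq_add_neg, hneg] at h
  exact h

omit [Fintype X] in
/-- **`‖D(χA)‖ ≤ ‖DA‖ + κ·‖(1 − χ)A‖`** for a linear `D` with `‖D‖ ≤ κ` (`χA = A − (1 − χ)A`). [cite: Balaban1989LargeFieldII, p.357 (bookkeeping: the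
replacement of the minimizer changes the form only through the far part)] -/
theorem l2n_D_mask_le (D : (F → ℝ) →ₗ[ℝ] (Y → ℝ)) {κ : ℝ} (hD : ∀ A, l2n (D A) ≤ κ * l2n A) (χ A : F → ℝ) :
    l2n (D (χ * A)) ≤ l2n (D A) + κ * l2n ((1 - χ) * A) := by
  have heq : χ * A = A - (1 - χ) * A := by
    ext f; simp only [Pi.mul_apply, Pi.sub_apply, Pi.one_apply]; ring
  rw [heq, map_sub]
  exact (l2n_sub_le _ _).trans (by linarith [hD ((1 - χ) * A)])

/-! ## §3. Each minimizer beats the cut-off of the other -/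

section Exchange

variable (H HZ : (X → ℝ) →ₗ[ℝ] (F → ℝ)) (D : (F → ℝ) →ₗ[ℝ] (Y → ℝ)) {KH KZH : g.Site → g.Site → ℝ}
  (hH : ∀ (y y' : g.Site) (u : X → ℝ), (∀ x, blkX x ≠ y' → u x = 0) →
    l2n (blockPiece blkF y (H u)) ≤ KH y y' * l2n u)
  (hHZ : ∀ (y y' : g.Site) (u : X → ℝ), (∀ x, blkX x ≠ y' → u x = 0) →
    l2n (blockPiece blkF y (HZ u)) ≤ KZH y y' * l2n u)
  (hKH0 : ∀ a b, 0 ≤ KH a b) (hKZH0 : ∀ a b, 0 ≤ KZH a b)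
  {CH δ R' c₂ κ : ℝ} (hCH : 0 ≤ CH) (hδ : 0 ≤ δ) (hc₂ : 0 ≤ c₂) (hκ : 0 ≤ κ)
  (hKH : ∀ a b, KH a b ≤ CH * Real.exp (-(δ * g.dist a b)))
  (hKZH : ∀ a b, KZH a b ≤ CH * Real.exp (-(δ * g.dist a b)))
  (hD : ∀ A, l2n (D A) ≤ κ * l2n A)
  (SF S' : Finset g.Site) (hsepF : ∀ y ∈ SF, ∀ y' ∈ S', R' ≤ g.dist y y')
  (hrowF : ∀ y ∈ SF, ∑ y' ∈ S', Real.exp (-(δ / 2 * g.dist y y')) ≤ c₂)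
  (hcolF : ∀ y' ∈ S', ∑ y ∈ SF, Real.exp (-(δ / 2 * g.dist y y')) ≤ c₂)
  (χ : F → ℝ) (hχ : ∀ f, |1 - χ f| ≤ 1) (hχS : ∀ f, χ f ≠ 1 → blkF f ∈ SF)
  (u : X → ℝ) (hu : ∀ x, blkX x ∉ S' → u x = 0)

include hH hKH0 hCH hδ hc₂ hκ hKH hD hsepF hrowF hcolF hχ hχS hu in
/-- **`‖∂A_Z‖ ≤ ‖∂A‖ + κ·C_H·c₂·e^{−δR′∕2}·‖u‖`** from the exchange hypothesis `‖∂A_Z‖ ≤ ‖∂(χA)‖` (the region minimizer beats the cut-off of the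
whole-lattice one: `χA ∈ Fib_Z u`, minimality (2.5)–(2.6)) and the far mass of `A = Hu`.
[cite: Balaban1989LargeFieldII, p.357; Balaban1984PropagatorsII, (2.5)–(2.6) p.224, (2.151) p.249] -/
theorem l2n_DHZ_le (hxZ : l2n (D (HZ u)) ≤ l2n (D (χ * H u))) :
    l2n (D (HZ u)) ≤ l2n (D (H u)) + κ * (CH * c₂ * Real.exp (-(δ * R' / 2))) * l2n u := by
  have hmS : ∀ f, (1 - χ) f ≠ 0 → blkF f ∈ SF := fun f hf => hχS f (fun h => hf (by simp [Pi.sub_apply, h]))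
  have hfar := farMass_le blkX blkF H hH hKH0 hCH hδ hc₂ hKH SF S' hsepF hrowF hcolF (1 - χ) (fun f => hχ f) hmS u hu
  calc l2n (D (HZ u)) ≤ l2n (D (χ * H u)) := hxZ
    _ ≤ l2n (D (H u)) + κ * l2n ((1 - χ) * H u) := l2n_D_mask_le D hD χ (H u)
    _ ≤ l2n (D (H u)) + κ * (CH * c₂ * Real.exp (-(δ * R' / 2)) * l2n u) := by
        have := mul_le_mul_of_nonneg_left hfar hκ
        linarith
    _ = l2n (D (H u)) + κ * (CH * c₂ * Real.exp (-(δ * R' / 2))) * l2n u := by ring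

include hHZ hKZH0 hCH hδ hc₂ hκ hKZH hD hsepF hrowF hcolF hχ hχS hu in
/-- **`‖∂A‖ ≤ ‖∂A_Z‖ + κ·C_H·c₂·e^{−δR′∕2}·‖u‖`** from the converse exchange hypothesis `‖∂A‖ ≤ ‖∂(χA_Z)‖` (`χA_Z ∈ Fib u`, minimality (1.65)) and
the far mass of `A_Z = H_Zu`. [cite: Balaban1989LargeFieldII, p.357; Balaban1984PropagatorsI, p.29 ((1.65)); Balaban1984PropagatorsII, (2.151) p.249] -/
theorem l2n_DH_le (hx : l2n (D (H u)) ≤ l2n (D (χ * HZ u))) :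
    l2n (D (H u)) ≤ l2n (D (HZ u)) + κ * (CH * c₂ * Real.exp (-(δ * R' / 2))) * l2n u := by
  have hmS : ∀ f, (1 - χ) f ≠ 0 → blkF f ∈ SF := fun f hf => hχS f (fun h => hf (by simp [Pi.sub_apply, h]))
  have hfar := farMass_le blkX blkF HZ hHZ hKZH0 hCH hδ hc₂ hKZH SF S' hsepF hrowF hcolF (1 - χ) (fun f => hχ f) hmS u hu
  calc l2n (D (H u)) ≤ l2n (D (χ * HZ u)) := hx
    _ ≤ l2n (D (HZ u)) + κ * l2n ((1 - χ) * HZ u) := l2n_D_mask_le D hD χ (HZ u)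
    _ ≤ l2n (D (HZ u)) + κ * (CH * c₂ * Real.exp (-(δ * R' / 2)) * l2n u) := by
        have := mul_le_mul_of_nonneg_left hfar hκ
        linarith
    _ = l2n (D (HZ u)) + κ * (CH * c₂ * Real.exp (-(δ * R' / 2))) * l2n u := by ring

include hH hHZ hKH0 hKZH0 hCH hδ hc₂ hκ hKH hKZH hD hsepF hrowF hcolF hχ hχS hu in
/-- **`|‖∂A_Z‖ − ‖∂A‖| ≤ κC_Hc₂·e^{−δR′∕2}·‖u‖`** (both exchanges). [cite: Balaban1989LargeFieldII, p.357] -/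
theorem abs_l2n_sub_le (hxZ : l2n (D (HZ u)) ≤ l2n (D (χ * H u))) (hx : l2n (D (H u)) ≤ l2n (D (χ * HZ u))) :
    |l2n (D (HZ u)) - l2n (D (H u))| ≤ κ * (CH * c₂ * Real.exp (-(δ * R' / 2))) * l2n u := by
  have h1 := l2n_DHZ_le blkX blkF H HZ D hH hKH0 hCH hδ hc₂ hκ hKH hD SF S' hsepF hrowF hcolF χ hχ hχS u hu hxZ
  have h2 := l2n_DH_le blkX blkF H HZ D hHZ hKZH0 hCH hδ hc₂ hκ hKZH hD SF S' hsepF hrowF hcolF χ hχ hχS u hu hx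
  rw [abs_le]; constructor <;> linarith

end Exchange

/-! ## §4. The minimizer-replacement error from minimality -/

/-- **THE MINIMIZER-REPLACEMENT ERROR FROM MINIMALITY** (*«Replacing the minimizer in this form by the kᵗʰ minimizer defined on the whole lattice …
we change the form by a quadratic form bounded by O(exp(−R_k))»*), WITHOUT a difference majorant.  Data: the two minimizers `H, H_Z` with block-`ℓ²`
majorants `≤ C_He^{−δd}` on the fine bonds; `T = D∘H`, `T_Z = D∘H_Z` with majorants `≤ Ce^{−δd}` on the outputs; `‖D‖ ≤ κ`; the cut-off `χ` (`|1 − χ| ≤ 1`,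
`χ = 1` off the fine blocks `S_F`, `S_F` separated from the input blocks `S′ ⊇ supp u` by `R′`); the two EXCHANGE hypotheses `‖∂A_Z‖ ≤ ‖∂(χA)‖`,
`‖∂A‖ ≤ ‖∂(χA_Z)‖`; a weight `0 ≤ w ≤ 1` with `1 − w` supported over output blocks `S` separated from `S′` by `R`; half-rate row∕column sums `≤ c`
(global, over `S′`), `≤ c₂` (between `S_F` and `S′`), `≤ c, c′` (between `S` and `S′`).  Then
`|Σ w·(T_Zu)² − Σ w·(Tu)²| ≤ (2κC_Hc₂·Cc·e^{−δR′∕2} + 2C²cc′·e^{−δR})·‖u‖²`.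
[cite: Balaban1989LargeFieldII, p.357, (1.7) p.358; Balaban1984PropagatorsII, (2.5)–(2.6) p.224, (2.61) p.234, (2.140) p.247, (2.151) p.249; Balaban1984PropagatorsI, (1.65)–(1.66) p.29] -/
theorem minimizerError_le_variational (H HZ : (X → ℝ) →ₗ[ℝ] (F → ℝ)) (D : (F → ℝ) →ₗ[ℝ] (Y → ℝ))
    {K KZ KH KZH : g.Site → g.Site → ℝ}
    (hT : ∀ (y y' : g.Site) (u : X → ℝ), (∀ x, blkX x ≠ y' → u x = 0) →
      l2n (blockPiece blkY y ((D ∘ₗ H) u)) ≤ K y y' * l2n u)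
    (hTZ : ∀ (y y' : g.Site) (u : X → ℝ), (∀ x, blkX x ≠ y' → u x = 0) →
      l2n (blockPiece blkY y ((D ∘ₗ HZ) u)) ≤ KZ y y' * l2n u)
    (hH : ∀ (y y' : g.Site) (u : X → ℝ), (∀ x, blkX x ≠ y' → u x = 0) →
      l2n (blockPiece blkF y (H u)) ≤ KH y y' * l2n u)
    (hHZ : ∀ (y y' : g.Site) (u : X → ℝ), (∀ x, blkX x ≠ y' → u x = 0) →
      l2n (blockPiece blkF y (HZ u)) ≤ KZH y y' * l2n u)
    (hK0 : ∀ a b, 0 ≤ K a b) (hKZ0 : ∀ a b, 0 ≤ KZ a b) (hKH0 : ∀ a b, 0 ≤ KH a b) (hKZH0 : ∀ a b, 0 ≤ KZH a b)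
    {C CH δ R R' c c' c₂ κ : ℝ} (hC : 0 ≤ C) (hCH : 0 ≤ CH) (hδ : 0 ≤ δ) (hc : 0 ≤ c) (hc₂ : 0 ≤ c₂)
    (hκ : 0 ≤ κ) (hd : ∀ a b, 0 ≤ g.dist a b)
    (hK : ∀ a b, K a b ≤ C * Real.exp (-(δ * g.dist a b))) (hKZ : ∀ a b, KZ a b ≤ C * Real.exp (-(δ * g.dist a b)))
    (hKH : ∀ a b, KH a b ≤ CH * Real.exp (-(δ * g.dist a b))) (hKZH : ∀ a b, KZH a b ≤ CH * Real.exp (-(δ * g.dist a b)))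
    (hD : ∀ A, l2n (D A) ≤ κ * l2n A)
    (S SF S' : Finset g.Site)
    (hsep : ∀ y ∈ S, ∀ y' ∈ S', R ≤ g.dist y y') (hsepF : ∀ y ∈ SF, ∀ y' ∈ S', R' ≤ g.dist y y')
    (hrow : ∀ y, ∑ y' ∈ S', Real.exp (-(δ / 2 * g.dist y y')) ≤ c)
    (hcol : ∀ y' ∈ S', ∑ y : g.Site, Real.exp (-(δ / 2 * g.dist y y')) ≤ c)
    (hcolS : ∀ y' ∈ S', ∑ y ∈ S, Real.exp (-(δ / 2 * g.dist y y')) ≤ c')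
    (hrowF : ∀ y ∈ SF, ∑ y' ∈ S', Real.exp (-(δ / 2 * g.dist y y')) ≤ c₂)
    (hcolF : ∀ y' ∈ S', ∑ y ∈ SF, Real.exp (-(δ / 2 * g.dist y y')) ≤ c₂)
    (χ : F → ℝ) (hχ : ∀ f, |1 - χ f| ≤ 1) (hχS : ∀ f, χ f ≠ 1 → blkF f ∈ SF)
    (w : Y → ℝ) (hw0 : ∀ x, 0 ≤ w x) (hw1 : ∀ x, w x ≤ 1) (hwS : ∀ x, w x ≠ 1 → blkY x ∈ S)
    (u : X → ℝ) (hu : ∀ x, blkX x ∉ S' → u x = 0)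
    (hxZ : l2n (D (HZ u)) ≤ l2n (D (χ * H u))) (hx : l2n (D (H u)) ≤ l2n (D (χ * HZ u))) :
    |∑ x : Y, w x * (D ∘ₗ HZ) u x ^ 2 - ∑ x : Y, w x * (D ∘ₗ H) u x ^ 2| ≤
      (2 * κ * CH * c₂ * C * c * Real.exp (-(δ * R' / 2)) + 2 * C ^ 2 * c * c' * Real.exp (-(δ * R))) * l2n u ^ 2 := by
  classical
  -- the global bounds `‖Tu‖, ‖T_Zu‖ ≤ Cc‖u‖`
  have hTu : l2n ((D ∘ₗ H) u) ≤ C * c * l2n u :=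
    l2n_apply_le_of_exp blkX blkY (D ∘ₗ H) hT hK0 hC hδ hc hd hK S' hrow hcol u hu
  have hTZu : l2n ((D ∘ₗ HZ) u) ≤ C * c * l2n u :=
    l2n_apply_le_of_exp blkX blkY (D ∘ₗ HZ) hTZ hKZ0 hC hδ hc hd hKZ S' hrow hcol u hu
  -- the difference of the norms from minimality
  have hdiff : |l2n ((D ∘ₗ HZ) u) - l2n ((D ∘ₗ H) u)| ≤ κ * (CH * c₂ * Real.exp (-(δ * R' / 2))) * l2n u := by
    simp only [LinearMap.comp_apply]
    exact abs_l2n_sub_le blkX blkF H HZ D hH hHZ hKH0 hKZH0 hCH hδ hc₂ hκ hKH hKZH hD SF S' hsepF hrowF hcolF χ hχ hχS u hu hxZ hx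
  -- `|‖T_Zu‖² − ‖Tu‖²| ≤ |‖T_Zu‖ − ‖Tu‖|·(‖T_Zu‖ + ‖Tu‖)`
  have hu0 : 0 ≤ l2n u := l2n_nonneg u
  have hsq : |l2n ((D ∘ₗ HZ) u) ^ 2 - l2n ((D ∘ₗ H) u) ^ 2| ≤
      κ * (CH * c₂ * Real.exp (-(δ * R' / 2))) * l2n u * (2 * (C * c * l2n u)) := by
    rw [sq_sub_sq, abs_mul]
    have hplus : |l2n ((D ∘ₗ HZ) u) + l2n ((D ∘ₗ H) u)| ≤ 2 * (C * c * l2n u) := by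
      rw [abs_of_nonneg (add_nonneg (l2n_nonneg _) (l2n_nonneg _))]; linarith
    exact mul_le_mul hplus hdiff (abs_nonneg _) (by positivity) |>.trans (le_of_eq (by ring))
  -- the weighted sums: `Σ w a² = ‖a‖² − Σ (1 − w) a²`
  have hsplit : ∀ a : Y → ℝ, ∑ x : Y, w x * a x ^ 2 = l2n a ^ 2 - ∑ x : Y, (1 - w x) * a x ^ 2 := by
    intro a
    rw [l2n_sq, ← Finset.sum_sub_distrib]
    exact Finset.sum_congr rfl fun x _ => by ring
  -- the two far parts by the prequel's `zetaError_le`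
  have hv0 : ∀ x, 0 ≤ 1 - w x := fun x => by linarith [hw1 x]
  have hv1 : ∀ x, 1 - w x ≤ 1 := fun x => by linarith [hw0 x]
  have hvS : ∀ x, 1 - w x ≠ 0 → blkY x ∈ S := fun x hx => hwS x (fun h => hx (by rw [h]; ring))
  have hrowS : ∀ y ∈ S, ∑ y' ∈ S', Real.exp (-(δ / 2 * g.dist y y')) ≤ c := fun y _ => hrow y
  have hζZ := zetaError_le blkX blkY (D ∘ₗ HZ) hTZ hKZ0 hC hδ hc hKZ S S' hsep hrowS hcolS (fun x => 1 - w x) hv0 hv1 hvS u hu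
  have hζ := zetaError_le blkX blkY (D ∘ₗ H) hT hK0 hC hδ hc hK S S' hsep hrowS hcolS (fun x => 1 - w x) hv0 hv1 hvS u hu
  rw [hsplit, hsplit]
  have hE : l2n ((D ∘ₗ HZ) u) ^ 2 - (∑ x : Y, (1 - w x) * (D ∘ₗ HZ) u x ^ 2) -
      (l2n ((D ∘ₗ H) u) ^ 2 - ∑ x : Y, (1 - w x) * (D ∘ₗ H) u x ^ 2) =
      (l2n ((D ∘ₗ HZ) u) ^ 2 - l2n ((D ∘ₗ H) u) ^ 2) -
        ((∑ x : Y, (1 - w x) * (D ∘ₗ HZ) u x ^ 2) - ∑ x : Y, (1 - w x) * (D ∘ₗ H) u x ^ 2) := by ring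
  rw [hE]
  refine (abs_sub _ _).trans ?_
  have h2 : |(∑ x : Y, (1 - w x) * (D ∘ₗ HZ) u x ^ 2) - ∑ x : Y, (1 - w x) * (D ∘ₗ H) u x ^ 2| ≤
      2 * C ^ 2 * c * c' * Real.exp (-(δ * R)) * l2n u ^ 2 := by
    refine (abs_sub _ _).trans ?_
    linarith
  calc |l2n ((D ∘ₗ HZ) u) ^ 2 - l2n ((D ∘ₗ H) u) ^ 2| +
        |(∑ x : Y, (1 - w x) * (D ∘ₗ HZ) u x ^ 2) - ∑ x : Y, (1 - w x) * (D ∘ₗ H) u x ^ 2|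
      ≤ κ * (CH * c₂ * Real.exp (-(δ * R' / 2))) * l2n u * (2 * (C * c * l2n u)) +
          2 * C ^ 2 * c * c' * Real.exp (-(δ * R)) * l2n u ^ 2 := add_le_add hsq h2
    _ = (2 * κ * CH * c₂ * C * c * Real.exp (-(δ * R' / 2)) + 2 * C ^ 2 * c * c' * Real.exp (-(δ * R))) * l2n u ^ 2 := by
        ring

/-- The same in print's letter: with `R_k ≤ δR′∕2` and `R_k ≤ δR`, `|E_H| ≤ (2κC_Hc₂Cc + 2C²cc′)·e^{−R_k}·‖u‖²` — the shape `|E_R| ≤ C₂e^{−R_k}‖B′‖²`.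
[cite: Balaban1989LargeFieldII, p.357, (1.7) p.358] -/
theorem minimizerError_le_variational_exp_Rk (H HZ : (X → ℝ) →ₗ[ℝ] (F → ℝ)) (D : (F → ℝ) →ₗ[ℝ] (Y → ℝ))
    {K KZ KH KZH : g.Site → g.Site → ℝ}
    (hT : ∀ (y y' : g.Site) (u : X → ℝ), (∀ x, blkX x ≠ y' → u x = 0) →
      l2n (blockPiece blkY y ((D ∘ₗ H) u)) ≤ K y y' * l2n u)
    (hTZ : ∀ (y y' : g.Site) (u : X → ℝ), (∀ x, blkX x ≠ y' → u x = 0) →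
      l2n (blockPiece blkY y ((D ∘ₗ HZ) u)) ≤ KZ y y' * l2n u)
    (hH : ∀ (y y' : g.Site) (u : X → ℝ), (∀ x, blkX x ≠ y' → u x = 0) →
      l2n (blockPiece blkF y (H u)) ≤ KH y y' * l2n u)
    (hHZ : ∀ (y y' : g.Site) (u : X → ℝ), (∀ x, blkX x ≠ y' → u x = 0) →
      l2n (blockPiece blkF y (HZ u)) ≤ KZH y y' * l2n u)
    (hK0 : ∀ a b, 0 ≤ K a b) (hKZ0 : ∀ a b, 0 ≤ KZ a b) (hKH0 : ∀ a b, 0 ≤ KH a b) (hKZH0 : ∀ a b, 0 ≤ KZH a b)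
    {C CH δ R R' c c' c₂ κ Rk : ℝ} (hC : 0 ≤ C) (hCH : 0 ≤ CH) (hδ : 0 ≤ δ) (hc : 0 ≤ c) (hc' : 0 ≤ c') (hc₂ : 0 ≤ c₂)
    (hκ : 0 ≤ κ) (hd : ∀ a b, 0 ≤ g.dist a b)
    (hK : ∀ a b, K a b ≤ C * Real.exp (-(δ * g.dist a b))) (hKZ : ∀ a b, KZ a b ≤ C * Real.exp (-(δ * g.dist a b)))
    (hKH : ∀ a b, KH a b ≤ CH * Real.exp (-(δ * g.dist a b))) (hKZH : ∀ a b, KZH a b ≤ CH * Real.exp (-(δ * g.dist a b)))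
    (hD : ∀ A, l2n (D A) ≤ κ * l2n A)
    (S SF S' : Finset g.Site)
    (hsep : ∀ y ∈ S, ∀ y' ∈ S', R ≤ g.dist y y') (hsepF : ∀ y ∈ SF, ∀ y' ∈ S', R' ≤ g.dist y y')
    (hrow : ∀ y, ∑ y' ∈ S', Real.exp (-(δ / 2 * g.dist y y')) ≤ c)
    (hcol : ∀ y' ∈ S', ∑ y : g.Site, Real.exp (-(δ / 2 * g.dist y y')) ≤ c)
    (hcolS : ∀ y' ∈ S', ∑ y ∈ S, Real.exp (-(δ / 2 * g.dist y y')) ≤ c')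
    (hrowF : ∀ y ∈ SF, ∑ y' ∈ S', Real.exp (-(δ / 2 * g.dist y y')) ≤ c₂)
    (hcolF : ∀ y' ∈ S', ∑ y ∈ SF, Real.exp (-(δ / 2 * g.dist y y')) ≤ c₂)
    (χ : F → ℝ) (hχ : ∀ f, |1 - χ f| ≤ 1) (hχS : ∀ f, χ f ≠ 1 → blkF f ∈ SF)
    (w : Y → ℝ) (hw0 : ∀ x, 0 ≤ w x) (hw1 : ∀ x, w x ≤ 1) (hwS : ∀ x, w x ≠ 1 → blkY x ∈ S)
    (u : X → ℝ) (hu : ∀ x, blkX x ∉ S' → u x = 0)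
    (hxZ : l2n (D (HZ u)) ≤ l2n (D (χ * H u))) (hx : l2n (D (H u)) ≤ l2n (D (χ * HZ u)))
    (hRk : Rk ≤ δ * R) (hRk' : Rk ≤ δ * R' / 2) :
    |∑ x : Y, w x * (D ∘ₗ HZ) u x ^ 2 - ∑ x : Y, w x * (D ∘ₗ H) u x ^ 2| ≤
      (2 * κ * CH * c₂ * C * c + 2 * C ^ 2 * c * c') * Real.exp (-Rk) * l2n u ^ 2 := by
  have h := minimizerError_le_variational blkX blkF blkY H HZ D hT hTZ hH hHZ hK0 hKZ0 hKH0 hKZH0 hC hCH hδ hc hc₂ hκ hd hK hKZ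
    hKH hKZH hD S SF S' hsep hsepF hrow hcol hcolS hrowF hcolF χ hχ hχS w hw0 hw1 hwS u hu hxZ hx
  have h1 : Real.exp (-(δ * R' / 2)) ≤ Real.exp (-Rk) := Real.exp_le_exp.mpr (by linarith)
  have h2 : Real.exp (-(δ * R)) ≤ Real.exp (-Rk) := Real.exp_le_exp.mpr (by linarith)
  have hA : 0 ≤ 2 * κ * CH * c₂ * C * c := by positivity
  have hB : 0 ≤ 2 * C ^ 2 * c * c' := by positivity
  refine h.trans ?_
  have hu2 : 0 ≤ l2n u ^ 2 := sq_nonneg _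
  have : (2 * κ * CH * c₂ * C * c * Real.exp (-(δ * R' / 2)) + 2 * C ^ 2 * c * c' * Real.exp (-(δ * R))) ≤
      (2 * κ * CH * c₂ * C * c + 2 * C ^ 2 * c * c') * Real.exp (-Rk) := by
    nlinarith [mul_le_mul_of_nonneg_left h1 hA, mul_le_mul_of_nonneg_left h2 hB]
  exact mul_le_mul_of_nonneg_right this hu2

/-! ## §5. (1.7) from the majorants of the two minimizers, minimality and located geometry -/

/-- ★★ **(1.7) WITH THE DIFFERENCE MAJORANT GONE.**  The splitting `Q = Σ_pζ₀(p)(T_ZB′)(p)² + E_A` of the form `⟨H_{1,k}B′, Δ₁(ζ₀)H_{1,k}B′⟩`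
(background-`1` form of the REGION minimizer + the first-order LETTER `|E_A| ≤ C₁M⁶R_kε_k‖B′‖²`), the block-`ℓ²` majorants of `H_k`, `H_{1,k,Z}`
(`≤ C_He^{−δd}`) and of `∂∘H_k`, `∂∘H_{1,k,Z}` (`≤ Ce^{−δd}`), `‖∂‖ ≤ κ`, the two EXCHANGE hypotheses (minimality over the cut-off-exchanged fibres), the
weight `0 ≤ ζ₀ ≤ 1` with `1 − ζ₀` over the blocks `S` (separation `R` from `S′ ⊇ supp B′`), the cut-off `χ` (`χ = 1` off the fine blocks `S_F`,
separation `R′`), the half-rate row∕column sums, `R_k ≤ δR`, `R_k ≤ δR′∕2`, and (1.67) as `γ₀‖∂B′‖² ≤ ‖∂H_kB′‖²` give r13's leaf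
`Ineq17 Q ‖∂B′‖² ‖B′‖² γ₀ (max C₁ (2κC_Hc₂Cc + 2C²cc′ + C²cc′)) M R_k ε_k` — BY NAME through the prequel's `ineq17_of_inputs_zeta`.
[cite: Balaban1989LargeFieldII, (1.7) pp.357–358; Balaban1984PropagatorsI, (1.65)–(1.67) p.29; Balaban1984PropagatorsII, (2.5)–(2.6) p.224, (2.61) p.234, (2.140) p.247, (2.151) p.249] -/
theorem ineq17_of_two_majorants (H HZ : (X → ℝ) →ₗ[ℝ] (F → ℝ)) (D : (F → ℝ) →ₗ[ℝ] (Y → ℝ))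
    {K KZ KH KZH : g.Site → g.Site → ℝ}
    (hT : ∀ (y y' : g.Site) (u : X → ℝ), (∀ x, blkX x ≠ y' → u x = 0) →
      l2n (blockPiece blkY y ((D ∘ₗ H) u)) ≤ K y y' * l2n u)
    (hTZ : ∀ (y y' : g.Site) (u : X → ℝ), (∀ x, blkX x ≠ y' → u x = 0) →
      l2n (blockPiece blkY y ((D ∘ₗ HZ) u)) ≤ KZ y y' * l2n u)
    (hH : ∀ (y y' : g.Site) (u : X → ℝ), (∀ x, blkX x ≠ y' → u x = 0) →
      l2n (blockPiece blkF y (H u)) ≤ KH y y' * l2n u)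
    (hHZ : ∀ (y y' : g.Site) (u : X → ℝ), (∀ x, blkX x ≠ y' → u x = 0) →
      l2n (blockPiece blkF y (HZ u)) ≤ KZH y y' * l2n u)
    (hK0 : ∀ a b, 0 ≤ K a b) (hKZ0 : ∀ a b, 0 ≤ KZ a b) (hKH0 : ∀ a b, 0 ≤ KH a b) (hKZH0 : ∀ a b, 0 ≤ KZH a b)
    {C CH δ R R' c c' c₂ κ Rk : ℝ} (hC : 0 ≤ C) (hCH : 0 ≤ CH) (hδ : 0 ≤ δ) (hc : 0 ≤ c) (hc' : 0 ≤ c') (hc₂ : 0 ≤ c₂)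
    (hκ : 0 ≤ κ) (hd : ∀ a b, 0 ≤ g.dist a b)
    (hK : ∀ a b, K a b ≤ C * Real.exp (-(δ * g.dist a b))) (hKZ : ∀ a b, KZ a b ≤ C * Real.exp (-(δ * g.dist a b)))
    (hKH : ∀ a b, KH a b ≤ CH * Real.exp (-(δ * g.dist a b))) (hKZH : ∀ a b, KZH a b ≤ CH * Real.exp (-(δ * g.dist a b)))
    (hD : ∀ A, l2n (D A) ≤ κ * l2n A)
    (S SF S' : Finset g.Site)
    (hsep : ∀ y ∈ S, ∀ y' ∈ S', R ≤ g.dist y y') (hsepF : ∀ y ∈ SF, ∀ y' ∈ S', R' ≤ g.dist y y')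
    (hrow : ∀ y, ∑ y' ∈ S', Real.exp (-(δ / 2 * g.dist y y')) ≤ c)
    (hcol : ∀ y' ∈ S', ∑ y : g.Site, Real.exp (-(δ / 2 * g.dist y y')) ≤ c)
    (hcolS : ∀ y' ∈ S', ∑ y ∈ S, Real.exp (-(δ / 2 * g.dist y y')) ≤ c')
    (hrowF : ∀ y ∈ SF, ∑ y' ∈ S', Real.exp (-(δ / 2 * g.dist y y')) ≤ c₂)
    (hcolF : ∀ y' ∈ S', ∑ y ∈ SF, Real.exp (-(δ / 2 * g.dist y y')) ≤ c₂)
    (χ : F → ℝ) (hχ : ∀ f, |1 - χ f| ≤ 1) (hχS : ∀ f, χ f ≠ 1 → blkF f ∈ SF)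
    (ζ : Y → ℝ) (hζ0 : ∀ x, 0 ≤ ζ x) (hζ1 : ∀ x, ζ x ≤ 1) (hζS : ∀ x, ζ x ≠ 1 → blkY x ∈ S)
    (u : X → ℝ) (hu : ∀ x, blkX x ∉ S' → u x = 0)
    (hxZ : l2n (D (HZ u)) ≤ l2n (D (χ * H u))) (hx : l2n (D (H u)) ≤ l2n (D (χ * HZ u)))
    (hRk : Rk ≤ δ * R) (hRk' : Rk ≤ δ * R' / 2)
    {Q EA ndB γ₀ C₁ M εk : ℝ} (hQ : Q = (∑ x : Y, ζ x * (D ∘ₗ HZ) u x ^ 2) + EA)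
    (h167 : γ₀ * ndB ≤ ∑ x : Y, (D ∘ₗ H) u x ^ 2)
    (hEA : |EA| ≤ C₁ * (M ^ 6 * Rk * εk) * l2n u ^ 2) (hX : 0 ≤ M ^ 6 * Rk * εk) :
    Ineq17 Q ndB (l2n u ^ 2) γ₀ (max C₁ ((2 * κ * CH * c₂ * C * c + 2 * C ^ 2 * c * c') + C ^ 2 * c * c')) M Rk εk := by
  classical
  -- the minimizer-replacement error
  set EH : ℝ := ∑ x : Y, ζ x * (D ∘ₗ HZ) u x ^ 2 - ∑ x : Y, ζ x * (D ∘ₗ H) u x ^ 2 with hEHdef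
  have hEH : |EH| ≤ (2 * κ * CH * c₂ * C * c + 2 * C ^ 2 * c * c') * Real.exp (-Rk) * l2n u ^ 2 :=
    minimizerError_le_variational_exp_Rk blkX blkF blkY H HZ D hT hTZ hH hHZ hK0 hKZ0 hKH0 hKZH0 hC hCH hδ hc hc' hc₂ hκ hd hK hKZ
      hKH hKZH hD S SF S' hsep hsepF hrow hcol hcolS hrowF hcolF χ hχ hχS ζ hζ0 hζ1 hζS u hu hxZ hx hRk hRk'
  -- `Σ ζ (Tu)² = Σ (Tu)² − Σ (1 − ζ)(Tu)²`
  have hsplit : ∑ x : Y, ζ x * (D ∘ₗ H) u x ^ 2 = ∑ x : Y, (D ∘ₗ H) u x ^ 2 + -(∑ x : Y, (1 - ζ x) * (D ∘ₗ H) u x ^ 2) := by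
    rw [← sub_eq_add_neg, ← Finset.sum_sub_distrib]
    exact Finset.sum_congr rfl fun x _ => by ring
  have hQ' : Q = (∑ x : Y, (D ∘ₗ H) u x ^ 2) + EA + (EH + -(∑ x : Y, (1 - ζ x) * (D ∘ₗ H) u x ^ 2)) := by
    rw [hQ, hEHdef, hsplit]; ring
  have hw0 : ∀ x, 0 ≤ 1 - ζ x := fun x => by linarith [hζ1 x]
  have hw1 : ∀ x, 1 - ζ x ≤ 1 := fun x => by linarith [hζ0 x]
  have hwS : ∀ x, 1 - ζ x ≠ 0 → blkY x ∈ S := fun x hx => hζS x (fun h => hx (by rw [h]; ring))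
  exact ineq17_of_inputs_zeta blkX blkY (D ∘ₗ H) hT hK0 hC hδ hc hc' hK S S' hsep (fun y _ => hrow y) hcolS (fun x => 1 - ζ x)
    hw0 hw1 hwS u hu hRk hQ' h167 hEA hEH hX

end Literature.MathematicalPhysics.QuantumFieldTheory.Balaban1983to89.B16Ineq17MinimizerErrorVariational

end
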